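import Summits.QuantumFields.YangMills.Theorems.DressedRitz.Negative.EchoZone
import HarnessLib

/-!
# Route `LuscherReduction`, crux `DressedRitz` (stmt-QuantumFields-20205), line «polyakovlift» r6/r7 — NEGATIVE LEMMA (tightness), sequel of `Negative/EchoZone`:
# the main-term identity `(g_i∘powLink L)·Φ̂₀^{R_v} = Ψ_{i+1}` FAILS beyond the first echo shell

* §4 ★★★ `shadow_identity_fails_at_echo` (pointwise: at every echo configuration `echoCfg L μ y` of a lit point `y` that the vacuum cut-off radius `R_v` reaches,
  the left side is `(f_{i+1}(y)/f_0(y))·f_0(gn U) ≠ 0` and the right side `(χ_R f_{i+1})(gn U) = 0`) and ★★★ `shadowObs_mul_ground_not_ae_beyond_echo` (the a.e.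
  identity is FALSE: both sides are continuous at the regular echo configuration — `continuousAt_gnCoord`, `continuousAt_rootRescale` of `…TransplantChart` —
  and `configMeasure` charges open sets, `configMeasure_isOpenPosMeasure`);
* §5 ★ `norm_gnCoord_echoCfg_le` (`‖gn(echoCfg)‖ ≤ 14/Λ` for `L ≥ 4`, via `tan α ≤ 2α` on `[0, 0.82]`, `π < 3.15`) and ★★★
  `shadowObs_mul_ground_not_ae_of_large_radius`: `R_v·Λ ≥ 14` and `L ≥ 4` already reach the echo zone.
* §6 ★ `norm_gnCoord_echoCfg_le_sharp` (`‖gn(echoCfg L μ y)‖ ≤ tan(π/L + μ‖y‖)/μ + ‖y‖ → 2π/Λ + 2‖y‖`) and ★★★ `shadowObs_mul_ground_not_ae_of_radius`: the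
  SHARP echo zone — every `R_v ≥ (2L/Λ)·tan(π/L + Λ‖y‖/(2L)) + ‖y‖` (`L ≥ 3`) fails the identity; asymptotically all `R_v > 2π/Λ`.

Consequence for the line: `hprod` of `concentration_transfer` (p563069) is available from `shadowObs_mul_ground_ae` (p557164) only for vacuum trial radii inside
the first echo shell, where `Negative/VacuumTrialRadius` (p561227) gives the defect floor `e^{-R_v/2} ≥ e^{-c/Λ}`; the r7 budget `e^{-1.1/Λ} ≲ Λ²` (hence
`lam0 ≲ 10⁻⁶`) is forced, not a choice of presentation.  HONEST FRAMING: finite-dimensional chart geometry on `SU(2)³`; does not refute `DressedRitz`; nothing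
here bears on infinite volume, the continuum limit or the Clay gap.  References: [cite: Luscher1983, §2–§3]; [cite: BrockerTomDieck1985, I (1.10)].
-/

set_option autoImplicit false

noncomputable section

open MeasureTheory Filter Topology Real
open Literature.MathematicalPhysics.QuantumFieldTheory (GaugeConfig Site gaugeTransform)
open Literature.Analysis.OperatorTheory.YMMatrixModel
open Literature.MathematicalPhysics.QuantumFieldTheory.Balaban1983to89.T4CubeChartGnomonic (gnoPoint continuous_gnoPoint)
open scoped BigOperators

namespace Summit.QuantumFields.YangMills.Theorems.FemtoTransferGap.PolyakovLift.Negative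

open Summit.QuantumFields.YangMills.Theorems.FemtoTransferGap
open Summit.QuantumFields.YangMills.Theorems.FemtoTransferGap.PolyakovLift

variable {k : ℕ}

/-! ## §4 ★★★ Beyond the first echo shell the main-term identity `(g_i∘powLink L)·Φ̂₀^{R_v} = Ψ_{i+1}` FAILS

The elementary sizes used below: for `‖y‖ ≤ R`, `RΛ ≤ 1/4`, `μ = Λ/(2L)`: `L·μ‖y‖ ≤ 1/8` (the fold configuration is near-centre and all `L·θ_j < π/2`), and for
`L ≥ 3` the echo angle `π/L + θ_0 ≤ π/3 + 1/24 < π/2`; the echoed link of `gn(echoCfg)` has gnomonic radius `tan(π/L + θ_0)/μ ≥ (π/L)/μ = 2π/Λ ≥ √2·R`. -/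

/-- Sizes at the lit ball: `L·(μ‖y‖) ≤ 1/8 < π/2` and `μ√(linkNormSq y j) ≤ 1/(8L)`, `μ = Λ/(2L)`. [folklore] -/
theorem fold_sizes {Λ R : ℝ} (hΛ : 0 < Λ) (hRΛ : R * Λ ≤ 1 / 4) {L : ℕ} (hL : 0 < L) {y : ZM} (hyR : ‖y‖ ≤ R) (j : Fin 3) :
    (L : ℝ) * (Λ / (2 * L) * ‖y‖) < π / 2 ∧ Λ / (2 * L) * Real.sqrt (linkNormSq y j) ≤ 1 / (8 * L) ∧
      (L : ℝ) * Real.arctan (Λ / (2 * L) * Real.sqrt (linkNormSq y j)) ≤ 1 / 8 := by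
  have hL' : (0 : ℝ) < L := Nat.cast_pos.mpr hL
  have hμ : 0 < Λ / (2 * L) := div_pos hΛ (by positivity)
  have hyn : 0 ≤ ‖y‖ := norm_nonneg y
  have hΛy : Λ * ‖y‖ ≤ 1 / 4 := by nlinarith [mul_le_mul_of_nonneg_left hyR hΛ.le]
  have h1 : (L : ℝ) * (Λ / (2 * L) * ‖y‖) = Λ * ‖y‖ / 2 := by field_simp
  have hsq : Real.sqrt (linkNormSq y j) ≤ ‖y‖ := sqrt_linkNormSq_le_norm y j
  have h2 : Λ / (2 * L) * Real.sqrt (linkNormSq y j) ≤ 1 / (8 * L) := by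
    calc Λ / (2 * L) * Real.sqrt (linkNormSq y j) ≤ Λ / (2 * L) * ‖y‖ := mul_le_mul_of_nonneg_left hsq hμ.le
      _ = Λ * ‖y‖ / (2 * L) := by ring
      _ ≤ (1 / 4) / (2 * L) := div_le_div_of_nonneg_right hΛy (by positivity)
      _ = 1 / (8 * L) := by ring
  have h3 : Real.arctan (Λ / (2 * L) * Real.sqrt (linkNormSq y j)) ≤ Λ / (2 * L) * Real.sqrt (linkNormSq y j) := by
    rcases (mul_nonneg hμ.le (Real.sqrt_nonneg (linkNormSq y j))).eq_or_lt with h0 | hpos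
    · rw [← h0, Real.arctan_zero]
    · exact (arctan_lt_self hpos).le
  refine ⟨by rw [h1]; linarith [Real.pi_gt_three], h2, ?_⟩
  calc (L : ℝ) * Real.arctan (Λ / (2 * L) * Real.sqrt (linkNormSq y j)) ≤ L * (1 / (8 * L)) := mul_le_mul_of_nonneg_left (h3.trans h2) hL'.le
    _ = 1 / 8 := by field_simp

/-- The echo angle of link `0` is `< π/2` for `L ≥ 3` at the lit ball. [folklore] -/
theorem echoAngle_lt {Λ R : ℝ} (hΛ : 0 < Λ) (hRΛ : R * Λ ≤ 1 / 4) {L : ℕ} (hL : 3 ≤ L) {y : ZM} (hyR : ‖y‖ ≤ R) :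
    π / L + Real.arctan (Λ / (2 * L) * Real.sqrt (linkNormSq y 0)) < π / 2 := by
  have hL0 : 0 < L := by omega
  have hL' : (3 : ℝ) ≤ L := by exact_mod_cast hL
  have hLpos : (0 : ℝ) < L := by linarith
  obtain ⟨-, h2, h3⟩ := fold_sizes hΛ hRΛ hL0 hyR 0
  have ha : Real.arctan (Λ / (2 * L) * Real.sqrt (linkNormSq y 0)) ≤ 1 / (8 * L) := by
    have := div_le_div_of_nonneg_right h3 hLpos.le
    rwa [mul_div_cancel_left₀ _ hLpos.ne', div_div] at this
  have hb : 1 / (8 * (L : ℝ)) ≤ 1 / 24 := div_le_div_of_nonneg_left (by norm_num) (by norm_num) (by linarith)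
  have hc : π / L ≤ π / 3 := div_le_div_of_nonneg_left Real.pi_pos.le (by norm_num) hL'
  linarith [Real.pi_gt_three]

/-- ★★★ **POINTWISE FAILURE AT EVERY ECHO CONFIGURATION.**  `μ = Λ/(2L)`, `L ≥ 3`, `RΛ ≤ 1/4`; `y` in the lit ball with `y_0 ≠ 0` and `f_{i+1}(y) ≠ 0`; `U = echoCfg L μ y`.
If the vacuum cut-off radius `R_v` reaches `gn U` (`‖gn U‖ ≤ R_v`), then at `U` the LEFT side `(g_i∘powLink L)(U)·(χ_{R_v} f_0)(gn U) = (f_{i+1}(y)/f_0(y))·f_0(gn U)` is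
NON-ZERO while the RIGHT side `(χ_R f_{i+1})(gn U)` is ZERO (the echoed link has gnomonic radius `≥ 2π/Λ > √2 R`).  The product identity of
`shadowObs_mul_ground_eq` (tree `…TransplantAE`, radius `2R`) therefore cannot be pushed past the first echo shell. [cite: Luscher1983, §2–§3] -/
theorem shadow_identity_fails_at_echo {Λ R Rv : ℝ} (hΛ : 0 < Λ) (hR : 0 < R) (hRΛ : R * Λ ≤ 1 / 4) (hRv : 0 < Rv) {L : ℕ} (hL : 3 ≤ L)
    (f : Fin (k + 1) → ZM → ℝ) (hpos : ∀ x, 0 < f 0 x) (i : Fin k) {y : ZM} (hyR : ‖y‖ ≤ R) (hy0 : 0 < linkNormSq y 0)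
    (hfy : f i.succ y ≠ 0) (hin : ‖gnCoord (Λ / (2 * L)) (echoCfg L (Λ / (2 * L)) y)‖ ≤ Rv) :
    transplantObsL L Λ R f i (powLink L (echoCfg L (Λ / (2 * L)) y)) *
          (radialCutoff Rv (gnCoord (Λ / (2 * L)) (echoCfg L (Λ / (2 * L)) y)) * f 0 (gnCoord (Λ / (2 * L)) (echoCfg L (Λ / (2 * L)) y))) ≠ 0 ∧
      radialCutoff R (gnCoord (Λ / (2 * L)) (echoCfg L (Λ / (2 * L)) y)) * f i.succ (gnCoord (Λ / (2 * L)) (echoCfg L (Λ / (2 * L)) y)) = 0 := by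
  have hL0 : 0 < L := by omega
  have hL' : (3 : ℝ) ≤ L := by exact_mod_cast hL
  have hLpos : (0 : ℝ) < L := by linarith
  have hμ : 0 < Λ / (2 * L) := div_pos hΛ (by positivity)
  obtain ⟨hsmall, -, -⟩ := fold_sizes hΛ hRΛ hL0 hyR 0
  have hang := echoAngle_lt hΛ hRΛ hL hyR
  refine ⟨?_, ?_⟩
  · rw [transplantObsL_powLink_echoCfg hL0 hΛ R f i hsmall hy0 hang, radialCutoff_eq_one hRv hin, transplantFn, radialCutoff_eq_one hR hyR]
    have h0 := hpos y
    have h1 := hpos (gnCoord (Λ / (2 * L)) (echoCfg L (Λ / (2 * L)) y))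
    exact mul_ne_zero (by rw [one_mul]; exact div_ne_zero hfy h0.ne') (by rw [one_mul]; exact h1.ne')
  · have hfar : 2 * R ^ 2 ≤ ‖gnCoord (Λ / (2 * L)) (echoCfg L (Λ / (2 * L)) y)‖ ^ 2 := by
      have h1 := linkNormSq_le_norm_sq (gnCoord (Λ / (2 * L)) (echoCfg L (Λ / (2 * L)) y)) 0
      rw [linkNormSq_gnCoord_echoCfg_zero hμ hy0] at h1
      -- the echoed radius: tan(π/L + θ_0)/μ ≥ (π/L)/μ = 2π/Λ
      have hα0 : 0 ≤ π / L + Real.arctan (Λ / (2 * L) * Real.sqrt (linkNormSq y 0)) := by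
        have ha : 0 ≤ Real.arctan (Λ / (2 * L) * Real.sqrt (linkNormSq y 0)) := by
          have := Real.arctan_strictMono.monotone (mul_nonneg hμ.le (Real.sqrt_nonneg (linkNormSq y 0))); rwa [Real.arctan_zero] at this
        have hb : 0 ≤ π / L := div_nonneg Real.pi_pos.le hLpos.le
        linarith
      have htan : π / L ≤ Real.tan (π / L + Real.arctan (Λ / (2 * L) * Real.sqrt (linkNormSq y 0))) := by
        have ha : 0 ≤ Real.arctan (Λ / (2 * L) * Real.sqrt (linkNormSq y 0)) := by
          have := Real.arctan_strictMono.monotone (mul_nonneg hμ.le (Real.sqrt_nonneg (linkNormSq y 0))); rwa [Real.arctan_zero] at this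
        exact (le_add_of_nonneg_right ha).trans (Real.le_tan hα0 hang)
      have hq : 2 * π / Λ ≤ Real.tan (π / L + Real.arctan (Λ / (2 * L) * Real.sqrt (linkNormSq y 0))) / (Λ / (2 * L)) := by
        rw [le_div_iff₀ hμ]
        calc 2 * π / Λ * (Λ / (2 * L)) = π / L := by field_simp
          _ ≤ _ := htan
      have hq0 : 0 ≤ 2 * π / Λ := by positivity
      have hsq : (2 * π / Λ) ^ 2 ≤ (Real.tan (π / L + Real.arctan (Λ / (2 * L) * Real.sqrt (linkNormSq y 0))) / (Λ / (2 * L))) ^ 2 :=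
        pow_le_pow_left₀ hq0 hq 2
      have hRΛ' : R ≤ 1 / (4 * Λ) := by rw [le_div_iff₀ (by positivity)]; linarith
      have hR2 : 2 * R ^ 2 ≤ (2 * π / Λ) ^ 2 := by
        have h3 : R ^ 2 ≤ (1 / (4 * Λ)) ^ 2 := pow_le_pow_left₀ hR.le hRΛ' 2
        have h4 : 2 * (1 / (4 * Λ)) ^ 2 ≤ (2 * π / Λ) ^ 2 := by
          have e1 : 2 * (1 / (4 * Λ)) ^ 2 = (1 / 8) / Λ ^ 2 := by field_simp; ring
          have e2 : (2 * π / Λ) ^ 2 = (4 * π ^ 2) / Λ ^ 2 := by field_simp; norm_num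
          rw [e1, e2]
          exact div_le_div_of_nonneg_right (by nlinarith [Real.pi_gt_three]) (by positivity)
        linarith
      linarith
    rw [radialCutoff_eq_zero hR hfar, zero_mul]

/-- ★★★ **FAILURE ON A SET OF POSITIVE MEASURE** (tightness of the vacuum trial radius in `shadowObs_mul_ground_ae`).  Under the hypotheses of
`shadow_identity_fails_at_echo` with all three `y_j ≠ 0` and the `f_j` continuous, the a.e. identity
`(g_i∘powLink L)·(χ_{R_v} f_0)(gn ·) =ᵐ (χ_R f_{i+1})(gn ·)` is FALSE: both sides are continuous at the (regular) echo configuration, where they differ, and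
`configMeasure` charges open sets.  Consequently the hypothesis `hprod` of `concentration_transfer` (tree `…ShadowVectorTransfer`) is available ONLY for vacuum
trial states supported inside the first echo shell, `R_v < (2π/Λ)·(1 + o(1))` — the floor `e^{-c/Λ}` of the vacuum defect (tree `Negative/VacuumTrialRadius`)
cannot be removed by enlarging `R_v`. [cite: Luscher1983, §2–§3] -/
theorem shadowObs_mul_ground_not_ae_beyond_echo {Λ R Rv : ℝ} (hΛ : 0 < Λ) (hR : 0 < R) (hRΛ : R * Λ ≤ 1 / 4) (hRv : 0 < Rv) {L : ℕ} (hL : 3 ≤ L)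
    (f : Fin (k + 1) → ZM → ℝ) (hcont : ∀ j, Continuous (f j)) (hpos : ∀ x, 0 < f 0 x) (i : Fin k) {y : ZM} (hyR : ‖y‖ ≤ R)
    (hyall : ∀ j, 0 < linkNormSq y j) (hfy : f i.succ y ≠ 0) (hin : ‖gnCoord (Λ / (2 * L)) (echoCfg L (Λ / (2 * L)) y)‖ ≤ Rv) :
    ¬ ((fun U : Cfg => transplantObsL L Λ R f i (powLink L U) * (radialCutoff Rv (gnCoord (Λ / (2 * L)) U) * f 0 (gnCoord (Λ / (2 * L)) U)))
        =ᵐ[configMeasure SU2 1] fun U => radialCutoff R (gnCoord (Λ / (2 * L)) U) * f i.succ (gnCoord (Λ / (2 * L)) U)) := by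
  have hL0 : 0 < L := by omega
  have hL' : (3 : ℝ) ≤ L := by exact_mod_cast hL
  have hLpos : (0 : ℝ) < L := by linarith
  have hμ : 0 < Λ / (2 * L) := div_pos hΛ (by positivity)
  have hang := echoAngle_lt hΛ hRΛ hL hyR
  set μ := Λ / (2 * L) with hμdef
  set U₀ : Cfg := echoCfg L μ y with hU₀def
  -- the difference of the two sides
  set D : Cfg → ℝ := fun U => transplantObsL L Λ R f i (powLink L U) * (radialCutoff Rv (gnCoord μ U) * f 0 (gnCoord μ U)) -
      radialCutoff R (gnCoord μ U) * f i.succ (gnCoord μ U) with hDdef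
  have hD0 : D U₀ ≠ 0 := by
    obtain ⟨h1, h2⟩ := shadow_identity_fails_at_echo hΛ hR hRΛ hRv hL f hpos i hyR (hyall 0) hfy hin
    simp only [hDdef, hU₀def, hμdef] at h1 h2 ⊢
    rw [h2, sub_zero]; exact h1
  -- regularity of the echo configuration and of its power
  have hoff : ∀ j : Fin 3, scalarPart (U₀ (edgeOf j)) ≠ 0 := fun j => (scalarPart_echoCfg_pos L μ y (edgeOf j)).ne'
  have hθ : ∀ j : Fin 3, 0 < (L : ℝ) * Real.arctan (μ * Real.sqrt (linkNormSq y j)) ∧ (L : ℝ) * Real.arctan (μ * Real.sqrt (linkNormSq y j)) < π / 2 := by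
    intro j
    obtain ⟨-, -, h3⟩ := fold_sizes hΛ hRΛ hL0 hyR j
    refine ⟨mul_pos hLpos (Real.arctan_pos.mpr (mul_pos hμ (Real.sqrt_pos.mpr (hyall j)))), ?_⟩
    linarith [Real.pi_gt_three]
  have hoffL : ∀ j : Fin 3, scalarPart (powLink L U₀ (edgeOf j)) ≠ 0 := by
    intro j
    rw [powLink_apply, hU₀def, echoCfg_edgeOf]
    by_cases hj : j = 0
    · rw [if_pos hj, scalarPart_pow_of_scalarPart_pos (scalarPart_echoLink_pos _ _)]
      have hW : 0 < gnNorm (gnoPoint (fun a => μ * y (j, a))) := by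
        rw [gnNorm_gnoPoint_link, abs_of_pos hμ]; exact mul_pos hμ (Real.sqrt_pos.mpr (hyall j))
      have hang' : π / L + Real.arctan (gnNorm (gnoPoint (fun a => μ * y (j, a)))) < π / 2 := by
        rw [gnNorm_gnoPoint_link, abs_of_pos hμ, hj]; exact hang
      rw [arctan_gnNorm_echoLink hW hang', gnNorm_gnoPoint_link, abs_of_pos hμ, mul_add, mul_div_cancel₀ _ hLpos.ne', add_comm, Real.cos_add_pi,
        neg_ne_zero]
      exact (Real.cos_pos_of_mem_Ioo ⟨by linarith [(hθ j).1, Real.pi_pos], (hθ j).2⟩).ne'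
    · rw [if_neg hj, scalarPart_pow_of_scalarPart_pos (scalarPart_gnoPoint_pos _), gnNorm_gnoPoint_link, abs_of_pos hμ]
      exact (Real.cos_pos_of_mem_Ioo ⟨by linarith [(hθ j).1, Real.pi_pos], (hθ j).2⟩).ne'
  have hreg : ∀ j : Fin 3, 0 < linkNormSq (gnCoord (Λ / 2) (powLink L U₀)) j := by
    intro j
    rw [hU₀def, gnCoord_powLink_echoCfg hL0 hμ (hyall 0) hang, linkNormSq_gnCoord_powLink_foldCfg hμ (half_pos hΛ).ne' j (hyall j)]
    exact pow_pos (div_pos (Real.tan_pos_of_pos_of_lt_pi_div_two (hθ j).1 (hθ j).2) (half_pos hΛ)) 2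
  -- continuity of D at U₀
  have hgn : ContinuousAt (gnCoord μ) U₀ := continuousAt_gnCoord μ hoff
  have hpow : Continuous (fun U : Cfg => powLink L U) := by
    have : (fun U : Cfg => powLink L U) = fun U e => U e ^ L := by funext U e; rw [powLink_apply]
    rw [this]; exact continuous_pi fun e => (continuous_apply e).pow L
  have hA : ContinuousAt (fun U : Cfg => gnCoord (Λ / 2) (powLink L U)) U₀ :=
    ContinuousAt.comp (g := gnCoord (Λ / 2)) (continuousAt_gnCoord (Λ / 2) hoffL) hpow.continuousAt
  have hB : ContinuousAt (fun U : Cfg => rootCoord L (Λ / 2) (powLink L U)) U₀ :=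
    ContinuousAt.comp (g := rootRescale L (Λ / 2)) (continuousAt_rootRescale L (half_pos hΛ) hreg) hA
  have hT : Continuous (transplantFn R f i) := by
    unfold transplantFn
    exact ((radialCutoff_contDiff R (n := 0)).continuous).mul (((hcont _).div (hcont 0)) fun x => (hpos x).ne')
  have hC : ContinuousAt (fun U : Cfg => transplantObsL L Λ R f i (powLink L U)) U₀ :=
    ContinuousAt.comp (g := transplantFn R f i) hT.continuousAt hB
  have hχv : Continuous (radialCutoff Rv) := (radialCutoff_contDiff Rv (n := 0)).continuous
  have hχ : Continuous (radialCutoff R) := (radialCutoff_contDiff R (n := 0)).continuous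
  have hD : ContinuousAt D U₀ := by
    refine (hC.mul ((hχv.continuousAt.comp hgn).mul ((hcont 0).continuousAt.comp hgn))).sub
      ((hχ.continuousAt.comp hgn).mul ((hcont i.succ).continuousAt.comp hgn))
  -- D ≠ 0 on a neighbourhood of U₀, which has positive measure
  intro hae
  have hev : ∀ᶠ U in 𝓝 U₀, D U ≠ 0 := hD.eventually_ne hD0
  obtain ⟨t, hts, ht_open, hU₀t⟩ := mem_nhds_iff.1 hev
  haveI := configMeasure_isOpenPosMeasure (G := SU2) 1
  have hpos' : 0 < configMeasure SU2 1 t := ht_open.measure_pos _ ⟨U₀, hU₀t⟩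
  have hzero' : ∀ᵐ U ∂(configMeasure SU2 1), D U = 0 := hae.mono fun U hU => by
    simp only at hU
    rw [hDdef]
    simp only [hU, sub_self]
  have hnull : configMeasure SU2 1 t = 0 := measure_mono_null (fun U hU => hts hU) (ae_iff.1 hzero')
  exact hpos'.ne' hnull


/-! ## §5 An explicit threshold: `R_v·Λ ≥ 14` (and `L ≥ 4`) already reaches the first echo shell -/

/-- `‖z‖² = Σ_j linkNormSq z j` on `ℝ⁹ = (ℝ³)³`. [folklore] -/
theorem norm_sq_eq_linkNormSq_sum (z : ZM) : ‖z‖ ^ 2 = linkNormSq z 0 + linkNormSq z 1 + linkNormSq z 2 := by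
  rw [EuclideanSpace.real_norm_sq_eq, Fintype.sum_prod_type, Fin.sum_univ_three]
  simp only [linkNormSq]

/-- ★ **Size of the echo configuration**: `‖gn(echoCfg L μ y)‖ ≤ 14/Λ` for `L ≥ 4`, `‖y‖ ≤ R`, `RΛ ≤ 1/4`, `y_0 ≠ 0` (`μ = Λ/(2L)`; the echoed link has gnomonic
radius `tan(π/L + θ_0)/μ ≤ 4(π + 1/8)/Λ`, by `tan α ≤ 2α` on `[0, 0.82]` and `π < 3.15`). [folklore] -/
theorem norm_gnCoord_echoCfg_le {Λ R : ℝ} (hΛ : 0 < Λ) (hRΛ : R * Λ ≤ 1 / 4) {L : ℕ} (hL : 4 ≤ L) {y : ZM} (hyR : ‖y‖ ≤ R)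
    (hy0 : 0 < linkNormSq y 0) : ‖gnCoord (Λ / (2 * L)) (echoCfg L (Λ / (2 * L)) y)‖ ≤ 14 / Λ := by
  have hL0 : 0 < L := by omega
  have hL' : (4 : ℝ) ≤ L := by exact_mod_cast hL
  have hLpos : (0 : ℝ) < L := by linarith
  have hμ : 0 < Λ / (2 * L) := div_pos hΛ (by positivity)
  obtain ⟨-, h2, -⟩ := fold_sizes hΛ hRΛ hL0 hyR 0
  have ha0 : 0 ≤ Real.arctan (Λ / (2 * L) * Real.sqrt (linkNormSq y 0)) := by
    have := Real.arctan_strictMono.monotone (mul_nonneg hμ.le (Real.sqrt_nonneg (linkNormSq y 0))); rwa [Real.arctan_zero] at this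
  have ha1 : Real.arctan (Λ / (2 * L) * Real.sqrt (linkNormSq y 0)) ≤ 1 / (8 * L) := by
    refine le_trans ?_ h2
    rcases (mul_nonneg hμ.le (Real.sqrt_nonneg (linkNormSq y 0))).eq_or_lt with h0 | hpos
    · rw [← h0, Real.arctan_zero]
    · exact (arctan_lt_self hpos).le
  have hπL : 0 < π / L := div_pos Real.pi_pos hLpos
  -- the echo angle α and tan α ≤ 2α ≤ 6.55/L
  generalize hα : π / L + Real.arctan (Λ / (2 * L) * Real.sqrt (linkNormSq y 0)) = α at *
  have hα0 : 0 ≤ α := by rw [← hα]; linarith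
  have hαL : α ≤ (π + 1 / 8) / L := by
    rw [← hα, add_div]
    have : 1 / (8 * (L : ℝ)) = 1 / 8 / L := by rw [div_div]
    linarith
  have hα1 : α ≤ 0.82 := by
    have h1 : (π + 1 / 8) / L ≤ (π + 1 / 8) / 4 := div_le_div_of_nonneg_left (by linarith [Real.pi_pos]) (by norm_num) hL'
    have h2 : (π + 1 / 8) / 4 ≤ 0.82 := by linarith [Real.pi_lt_d2]
    linarith
  have hcos : 1 / 2 ≤ Real.cos α := by nlinarith [Real.one_sub_sq_div_two_le_cos (x := α), mul_le_mul hα1 hα1 hα0 (by norm_num : (0:ℝ) ≤ 0.82)]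
  have htan : Real.tan α ≤ 2 * α := by
    rw [Real.tan_eq_sin_div_cos, div_le_iff₀ (by linarith)]
    nlinarith [Real.sin_le hα0, mul_nonneg hα0 (by linarith : (0 : ℝ) ≤ 2 * Real.cos α - 1)]
  have htanL : Real.tan α ≤ 6.55 / L := by
    have h1 : 2 * ((π + 1 / 8) / L) ≤ 6.55 / L := by
      rw [← mul_div_assoc]; exact div_le_div_of_nonneg_right (by linarith [Real.pi_lt_d2]) hLpos.le
    linarith
  have hT : Real.tan α / (Λ / (2 * L)) ≤ 13.1 / Λ := by
    calc Real.tan α / (Λ / (2 * L)) ≤ (6.55 / L) / (Λ / (2 * L)) := div_le_div_of_nonneg_right htanL hμ.le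
      _ = 13.1 / Λ := by field_simp; ring
  have hT0 : 0 ≤ Real.tan α / (Λ / (2 * L)) := div_nonneg (Real.tan_nonneg_of_nonneg_of_le_pi_div_two hα0 (by linarith [Real.pi_gt_three])) hμ.le
  -- the norm
  have hz := norm_sq_eq_linkNormSq_sum (gnCoord (Λ / (2 * L)) (echoCfg L (Λ / (2 * L)) y))
  rw [linkNormSq_gnCoord_echoCfg_zero hμ hy0, hα, linkNormSq_gnCoord_echoCfg_ne hμ y (by decide : (1 : Fin 3) ≠ 0),
    linkNormSq_gnCoord_echoCfg_ne hμ y (by decide : (2 : Fin 3) ≠ 0)] at hz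
  have hy := norm_sq_eq_linkNormSq_sum y
  have hyR2 : ‖y‖ ^ 2 ≤ (1 / (4 * Λ)) ^ 2 := by
    have hRΛ' : R ≤ 1 / (4 * Λ) := by rw [le_div_iff₀ (by positivity)]; linarith
    exact pow_le_pow_left₀ (norm_nonneg y) (hyR.trans hRΛ') 2
  have hT2 : (Real.tan α / (Λ / (2 * L))) ^ 2 ≤ (13.1 / Λ) ^ 2 := pow_le_pow_left₀ hT0 hT 2
  have hsq : ‖gnCoord (Λ / (2 * L)) (echoCfg L (Λ / (2 * L)) y)‖ ^ 2 ≤ (14 / Λ) ^ 2 := by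
    have h14 : (13.1 / Λ) ^ 2 + (1 / (4 * Λ)) ^ 2 ≤ (14 / Λ) ^ 2 := by
      rw [div_pow, div_pow, div_pow, mul_pow, div_add_div _ _ (by positivity) (by positivity), div_le_div_iff₀ (by positivity) (by positivity)]
      nlinarith [pow_pos hΛ 2, pow_pos hΛ 4]
    nlinarith [linkNormSq_nonneg y 0]
  exact (sq_le_sq₀ (norm_nonneg _) (by positivity)).1 hsq

/-- ★★★ **TIGHTNESS OF THE VACUUM TRIAL RADIUS (explicit form).**  For `L ≥ 4`, `RΛ ≤ 1/4`, `R_v·Λ ≥ 14`, an eigen-family `f` with `f_0 > 0` and continuous members,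
and ANY point `y` of the lit ball with non-zero link vectors at which `f_{i+1}(y) ≠ 0` (such points exist whenever `f_{i+1} ≢ 0` near the origin — the zero set of a
non-trivial continuous function does not contain the open regular set), the product identity
`(g_i∘powLink L)·(χ_{R_v} f_0)(gn ·) =ᵐ (χ_R f_{i+1})(gn ·)` FAILS.  The a.e. identity `shadowObs_mul_ground_ae` (vacuum radius `2R ≤ 1/(2Λ)`) is thus available only
INSIDE the first echo shell `R_v ≲ 2π/Λ`, where the vacuum defect has the floor `e^{-R_v/2} ≥ e^{-c/Λ}` (`Negative/VacuumTrialRadius`): the «`e^{-1.1/Λ}` budget» of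
the r7 line is forced, not a choice. [cite: Luscher1983, §2–§3] -/
theorem shadowObs_mul_ground_not_ae_of_large_radius {Λ R Rv : ℝ} (hΛ : 0 < Λ) (hR : 0 < R) (hRΛ : R * Λ ≤ 1 / 4) (hRvΛ : 14 ≤ Rv * Λ) {L : ℕ}
    (hL : 4 ≤ L) (f : Fin (k + 1) → ZM → ℝ) (hcont : ∀ j, Continuous (f j)) (hpos : ∀ x, 0 < f 0 x) (i : Fin k) {y : ZM} (hyR : ‖y‖ ≤ R)
    (hyall : ∀ j, 0 < linkNormSq y j) (hfy : f i.succ y ≠ 0) :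
    ¬ ((fun U : Cfg => transplantObsL L Λ R f i (powLink L U) * (radialCutoff Rv (gnCoord (Λ / (2 * L)) U) * f 0 (gnCoord (Λ / (2 * L)) U)))
        =ᵐ[configMeasure SU2 1] fun U => radialCutoff R (gnCoord (Λ / (2 * L)) U) * f i.succ (gnCoord (Λ / (2 * L)) U)) := by
  have hRv : 0 < Rv := by nlinarith
  have hin : ‖gnCoord (Λ / (2 * L)) (echoCfg L (Λ / (2 * L)) y)‖ ≤ Rv := by
    refine (norm_gnCoord_echoCfg_le hΛ hRΛ hL hyR (hyall 0)).trans ?_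
    rw [div_le_iff₀ hΛ]; exact hRvΛ
  exact shadowObs_mul_ground_not_ae_beyond_echo hΛ hR hRΛ hRv (by omega) f hcont hpos i hyR hyall hfy hin


/-! ## §6 The sharp size of the echo configuration: radii `R_v > 2π/Λ` are eventually in the echo zone -/

/-- ★ **Sharp size of the echo configuration**: `‖gn(echoCfg L μ y)‖ ≤ tan(π/L + μ‖y‖)/μ + ‖y‖` (`y_0 ≠ 0`, `π/L + μ‖y‖ < π/2`).  With `μ = Λ/(2L)` the right side is
`(2L/Λ)·tan(π/L + Λ‖y‖/(2L)) + ‖y‖ → 2π/Λ + 2‖y‖` (`L → ∞`): every vacuum radius `R_v > 2π/Λ` reaches, for `L` large, the echo configurations of all lit points with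
`‖y‖ < (R_v − 2π/Λ)/2`. [folklore] -/
theorem norm_gnCoord_echoCfg_le_sharp {L : ℕ} {μ : ℝ} (hμ : 0 < μ) {y : ZM} (hy0 : 0 < linkNormSq y 0) (hang : π / L + μ * ‖y‖ < π / 2) :
    ‖gnCoord μ (echoCfg L μ y)‖ ≤ Real.tan (π / L + μ * ‖y‖) / μ + ‖y‖ := by
  have hπL : 0 ≤ π / L := div_nonneg Real.pi_pos.le (Nat.cast_nonneg L)
  have ha0 : 0 ≤ Real.arctan (μ * Real.sqrt (linkNormSq y 0)) := by
    have := Real.arctan_strictMono.monotone (mul_nonneg hμ.le (Real.sqrt_nonneg (linkNormSq y 0))); rwa [Real.arctan_zero] at this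
  have ha1 : Real.arctan (μ * Real.sqrt (linkNormSq y 0)) ≤ μ * ‖y‖ := by
    refine le_trans ?_ (mul_le_mul_of_nonneg_left (sqrt_linkNormSq_le_norm y 0) hμ.le)
    rcases (mul_nonneg hμ.le (Real.sqrt_nonneg (linkNormSq y 0))).eq_or_lt with h0 | hpos
    · rw [← h0, Real.arctan_zero]
    · exact (arctan_lt_self hpos).le
  have hα0 : 0 ≤ π / L + Real.arctan (μ * Real.sqrt (linkNormSq y 0)) := by linarith
  have hαle : π / L + Real.arctan (μ * Real.sqrt (linkNormSq y 0)) ≤ π / L + μ * ‖y‖ := by linarith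
  have htan_mono : Real.tan (π / L + Real.arctan (μ * Real.sqrt (linkNormSq y 0))) ≤ Real.tan (π / L + μ * ‖y‖) :=
    Real.strictMonoOn_tan.monotoneOn ⟨by linarith [Real.pi_pos], by linarith⟩ ⟨by linarith [Real.pi_pos], hang⟩ hαle
  have htan0 : 0 ≤ Real.tan (π / L + Real.arctan (μ * Real.sqrt (linkNormSq y 0))) :=
    Real.tan_nonneg_of_nonneg_of_le_pi_div_two hα0 (by linarith)
  have hT : Real.tan (π / L + Real.arctan (μ * Real.sqrt (linkNormSq y 0))) / μ ≤ Real.tan (π / L + μ * ‖y‖) / μ :=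
    div_le_div_of_nonneg_right htan_mono hμ.le
  have hT0 : 0 ≤ Real.tan (π / L + Real.arctan (μ * Real.sqrt (linkNormSq y 0))) / μ := div_nonneg htan0 hμ.le
  have hz := norm_sq_eq_linkNormSq_sum (gnCoord μ (echoCfg L μ y))
  rw [linkNormSq_gnCoord_echoCfg_zero hμ hy0, linkNormSq_gnCoord_echoCfg_ne hμ y (by decide : (1 : Fin 3) ≠ 0),
    linkNormSq_gnCoord_echoCfg_ne hμ y (by decide : (2 : Fin 3) ≠ 0)] at hz
  have hy := norm_sq_eq_linkNormSq_sum y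
  have hsq : ‖gnCoord μ (echoCfg L μ y)‖ ^ 2 ≤ (Real.tan (π / L + μ * ‖y‖) / μ + ‖y‖) ^ 2 := by
    have h2 : (Real.tan (π / L + Real.arctan (μ * Real.sqrt (linkNormSq y 0))) / μ) ^ 2 ≤ (Real.tan (π / L + μ * ‖y‖) / μ) ^ 2 :=
      pow_le_pow_left₀ hT0 hT 2
    nlinarith [linkNormSq_nonneg y 0, norm_nonneg y, hT0.trans hT]
  exact (sq_le_sq₀ (norm_nonneg _) (add_nonneg (hT0.trans hT) (norm_nonneg y))).1 hsq

/-- ★★★ **Echo zone, sharp form**: for `L ≥ 3`, `RΛ ≤ 1/4`, a regular lit point `y` with `f_{i+1}(y) ≠ 0` and ANY vacuum radius with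
`(2L/Λ)·tan(π/L + Λ‖y‖/(2L)) + ‖y‖ ≤ R_v` (asymptotically `R_v ≥ 2π/Λ + 2‖y‖`), the a.e. main-term identity FAILS. [cite: Luscher1983, §2–§3] -/
theorem shadowObs_mul_ground_not_ae_of_radius {Λ R Rv : ℝ} (hΛ : 0 < Λ) (hR : 0 < R) (hRΛ : R * Λ ≤ 1 / 4) {L : ℕ} (hL : 3 ≤ L)
    (f : Fin (k + 1) → ZM → ℝ) (hcont : ∀ j, Continuous (f j)) (hpos : ∀ x, 0 < f 0 x) (i : Fin k) {y : ZM} (hyR : ‖y‖ ≤ R)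
    (hyall : ∀ j, 0 < linkNormSq y j) (hfy : f i.succ y ≠ 0) (hRv : Real.tan (π / L + Λ / (2 * L) * ‖y‖) / (Λ / (2 * L)) + ‖y‖ ≤ Rv) :
    ¬ ((fun U : Cfg => transplantObsL L Λ R f i (powLink L U) * (radialCutoff Rv (gnCoord (Λ / (2 * L)) U) * f 0 (gnCoord (Λ / (2 * L)) U)))
        =ᵐ[configMeasure SU2 1] fun U => radialCutoff R (gnCoord (Λ / (2 * L)) U) * f i.succ (gnCoord (Λ / (2 * L)) U)) := by
  have hL0 : 0 < L := by omega
  have hL' : (3 : ℝ) ≤ L := by exact_mod_cast hL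
  have hLpos : (0 : ℝ) < L := by linarith
  have hμ : 0 < Λ / (2 * L) := div_pos hΛ (by positivity)
  obtain ⟨hsmall, -, -⟩ := fold_sizes hΛ hRΛ hL0 hyR 0
  -- the angle π/L + μ‖y‖ ≤ π/3 + 1/24 < π/2
  have hang : π / L + Λ / (2 * L) * ‖y‖ < π / 2 := by
    have h1 : Λ / (2 * L) * ‖y‖ ≤ 1 / (8 * L) := by
      have hΛy : Λ * ‖y‖ ≤ 1 / 4 := by nlinarith [mul_le_mul_of_nonneg_left hyR hΛ.le, norm_nonneg y]
      calc Λ / (2 * L) * ‖y‖ = Λ * ‖y‖ / (2 * L) := by ring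
        _ ≤ (1 / 4) / (2 * L) := div_le_div_of_nonneg_right hΛy (by positivity)
        _ = 1 / (8 * L) := by ring
    have hb : 1 / (8 * (L : ℝ)) ≤ 1 / 24 := div_le_div_of_nonneg_left (by norm_num) (by norm_num) (by linarith)
    have hc : π / L ≤ π / 3 := div_le_div_of_nonneg_left Real.pi_pos.le (by norm_num) hL'
    linarith [Real.pi_gt_three]
  have hpos' : 0 < Real.tan (π / L + Λ / (2 * L) * ‖y‖) / (Λ / (2 * L)) + ‖y‖ := by
    have h1 : 0 < π / L + Λ / (2 * L) * ‖y‖ := by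
      have := div_pos Real.pi_pos hLpos; have := mul_nonneg hμ.le (norm_nonneg y); linarith
    have := Real.tan_pos_of_pos_of_lt_pi_div_two h1 hang
    have := norm_nonneg y
    positivity
  have hin : ‖gnCoord (Λ / (2 * L)) (echoCfg L (Λ / (2 * L)) y)‖ ≤ Rv :=
    (norm_gnCoord_echoCfg_le_sharp hμ (hyall 0) hang).trans hRv
  exact shadowObs_mul_ground_not_ae_beyond_echo hΛ hR hRΛ (hpos'.trans_le hRv) hL f hcont hpos i hyR hyall hfy hin

end Summit.QuantumFields.YangMills.Theorems.FemtoTransferGap.PolyakovLift.Negative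

end
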